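import Summits.QuantumAdvantage.QuantumAdvantage.Theorems.CubicForrelationNearExactIsExactTwelveTypeO992At2932
import Summits.QuantumAdvantage.QuantumAdvantage.Theorems.CubicForrelationNearExactIsExactTwelveBase992CharSums

/-!
# Crux `CubicForrelation.NearExactIsExact` (stmt-QuantumAdvantage-14043) — n = 12, type O with base set `992` AT `Φ = 29/32`: a level-`≥ 6`
  PARTNER is impossible (the `256` characters carrying the aligned wild points would have to be a whole hyperplane of `2048`)

Certificate seat `b2b-cforr-cert` (gen 22).  HONEST FRAMING: a kernel-checked lemma (standard axioms, no `decide`) about cubic Boolean pairs on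
12 bits — the type-O(base `992`) × level-`≥ 6` configuration of the boundary rung `29/32` (HOME/b2b-cforr-cert-g22/PLAN-N12-928-EQ.md).  With
`to22_typeO_E992_typeO_partner_false` only the level-5 partner of a base-`992` type-O side remains (it is reduced to the rigid level-5
configurations by `tw22_levelFive_ge2932_partner`).  NO new value of `θ₁₂`.  NOT summit progress.

`to22_typeO_E992_levelSix_partner_false`: cubic `f, g`, `W_g = 16u` (some `u` odd) with `#E = 992`, `W_f = 64w_f`, `Φ(f,g) ≥ 29/32` is
impossible.  Proof: by `to22_typeO_E992_ge2932_dichotomy` the wild function `v` has `v̂ = 8k`, `k ∈ {0, ±2}`, `k ≠ 0` on exactly `256`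
characters; by `to22_char_sum_E992_structure` the character sums of `E` are `Ê = 32m` with `m` odd exactly on a hyperplane `M ∋ 0`
(`#M = 2048`); the partner identity (`to18_typeO_partner_identity`) with `u_f = 4w_f` reads `4w_f(y) = 4(−1)^g − 64s_b[y = c₁] + 2s_b m(c₁⊕y) − k(y)`,
so `k(y) ≡ 2m(c₁ ⊕ y) (mod 4)`: `k(y) ≠ 0 ⇔ c₁ ⊕ y ∈ M`, i.e. on `2048` characters — contradiction.

References: Kasami–Tokura (1970); MacWilliams–Sloane (1977) Ch. 13–15; O'Donnell (2014) §3.3.  Axioms: the standard three.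
-/

set_option linter.dupNamespace false -- D-0017: single-problem summit ⇒ `QuantumAdvantage.QuantumAdvantage` by design

noncomputable section

namespace Summit.QuantumAdvantage.QuantumAdvantage.Theorems.CubicForrelation.NearExactIsExact

open Finset
open Literature.Computability.QuantumComplexity
open Literature.Computability.QuantumComplexity.BuzetChailloux (bxor zeroVec bxor_bxor_cancel_left bxor_zeroVec zeroVec_bxor bxor_comm
  bxor_self twist_zeroVec_right twist_bxor_right)
open Literature.Computability.QuantumComplexity.DerivativeWalsh (W)
open Summit.QuantumAdvantage.QuantumAdvantage.Theorems.NearExactIsExact.Negative (TypeOTwelve.typeO_of_exists_odd)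

/-- **No type-O(base `992`) × level-`≥ 6` pair at `Φ ≥ 29/32`** (12 bits).  See the module docstring.  Finite-slice statement, NOT summit
progress. [this work] -/
theorem to22_typeO_E992_levelSix_partner_false (f g : (Fin (6 + 6) → Bool) → Bool) (hf : IsDegLeFun 3 f) (hg : IsDegLeFun 3 g)
    (u : (Fin (6 + 6) → Bool) → ℤ) (hu : ∀ x, W (fun y => signOf (g y)) x = (2 : ℝ) ^ 4 * (u x : ℝ))
    (hodd : ∃ x, Odd (u x)) (hE : #(univ.filter fun x : Fin (6 + 6) → Bool => (Odd (u x / 2) ↔ Odd (u x / 2 / 2))) = 992)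
    (wf : (Fin (6 + 6) → Bool) → ℤ) (hwf : ∀ y, W (fun x => signOf (f x)) y = (2 : ℝ) ^ 6 * (wf y : ℝ))
    (hΦ : (29 / 32 : ℝ) ≤ forrelation f g) : False := by
  classical
  obtain ⟨-, uf, huf, -, v, hv, -, k, hk8, -, hkval, hcard⟩ := to22_typeO_E992_ge2932_dichotomy f g hf hg u hu hodd hE hΦ
  -- `u_f = 4 w_f`
  have huw : ∀ y, uf y = 4 * wf y := by
    intro y
    have h := (huf y).symm.trans (hwf y)
    have h' : ((uf y : ℤ) : ℝ) = ((4 * wf y : ℤ) : ℝ) := by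
      push_cast
      have h2 : (2 : ℝ) ^ 4 ≠ 0 := by norm_num
      have : (2 : ℝ) ^ 4 * (uf y : ℝ) = (2 : ℝ) ^ 4 * (4 * (wf y : ℝ)) := by rw [h]; ring
      exact mul_left_cancel₀ h2 this
    exact_mod_cast h'
  -- the affine digit and the base set as a cubic support
  have hall : ∀ x, Odd (u x) := TypeOTwelve.typeO_of_exists_odd g u hg hu hodd
  have hu' : ∀ x, W (fun y => signOf (g y)) x = (2 : ℝ) ^ (2 * 2) * (u x : ℝ) := fun x => (hu x).trans (by norm_num)
  have hd1 : IsDegLeFun 1 (fun x => decide (Odd (u x / 2))) := z2_digitOne 2 g u hg hu' hall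
  have hd2 : IsDegLeFun 3 (fun x => decide (Odd (u x / 2 / 2))) := z2_digitTwo 2 g u hg hu' hall
  obtain ⟨c₁, b₁, hcb⟩ := stub_affineForm (6 + 6) _ hd1
  set E := univ.filter (fun x : Fin (6 + 6) → Bool => (Odd (u x / 2) ↔ Odd (u x / 2 / 2))) with hEdef
  have hdegE : IsDegLeFun (2 + 1) (fun x => (decide (Odd (u x / 2)) ^^ decide (Odd (u x / 2 / 2))) ^^ true) :=
    tb_isDegLeFun_xor_const (bb_isDegLeFun_bxor (hd1.mono (by norm_num)) hd2) true
  have hsetE : (univ.filter fun x : Fin (6 + 6) → Bool =>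
      ((decide (Odd (u x / 2)) ^^ decide (Odd (u x / 2 / 2))) ^^ true) = true) = E := by
    rw [hEdef]
    apply filter_congr
    intro x _
    by_cases h1 : Odd (u x / 2) <;> by_cases h2 : Odd (u x / 2 / 2) <;> simp [h1, h2]
  -- the character sums of `E`: `Ê = 32 m`, `m` odd exactly on a hyperplane `M`
  obtain ⟨mf, M, hEm, hM0, hMadd, hMcard, hMpar⟩ := to22_char_sum_E992_structure _ hdegE (by rw [hsetE]; exact hE)
  rw [hsetE] at hEm
  -- the partner identity
  have hsb : ((sZ b₁ : ℤ) : ℝ) = signOf b₁ := tp_sZ_cast _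
  have hkm : ∀ y, k y = 4 * sZ (g y) - 64 * sZ b₁ * (if bxor c₁ y = (fun _ => false) then 1 else 0) +
      2 * sZ b₁ * mf (bxor c₁ y) - 4 * wf y := by
    intro y
    have h := to18_typeO_partner_identity f g u hu v hv c₁ b₁ hcb uf huf y
    rw [← hEdef, hEm, hk8, huw] at h
    have h' : ((k y : ℤ) : ℝ) = ((4 * sZ (g y) - 64 * sZ b₁ * (if bxor c₁ y = (fun _ => false) then 1 else 0) +
        2 * sZ b₁ * mf (bxor c₁ y) - 4 * wf y : ℤ) : ℝ) := by
      have hsg := tp_sZ_cast (g y)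
      rcases tp_sZ_cases b₁ with hs | hs
      all_goals
        rw [hs] at hsb ⊢
        push_cast at hsb h ⊢
        rw [← hsb, ← hsg] at h
        split_ifs with hz
        · rw [if_pos hz] at h
          have e4096 : (2 : ℝ) ^ (6 + 6) = 4096 := by norm_num
          rw [e4096] at h
          linarith
        · rw [if_neg hz] at h
          linarith
    exact_mod_cast h'
  -- `k ≠ 0 ⇔ m(c₁ ⊕ y)` odd
  have hkiff : ∀ y, k y ≠ 0 ↔ bxor c₁ y ∈ M := by
    intro y
    rw [← hMpar, Int.odd_iff]
    have h := hkm y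
    have hsg := tp_sZ_cases (g y)
    rcases tp_sZ_cases b₁ with hs | hs <;> rw [hs] at h <;> rcases hkval y with hk | hk | hk <;> rw [hk] at h ⊢ <;>
      split_ifs at h <;> omega
  -- so `{k ≠ 0}` is the translate of `M`: `2048` points, not `256`
  have hset : (univ.filter fun y : Fin (6 + 6) → Bool => k y ≠ 0) = M.image (bxor c₁) := by
    ext y
    rw [mem_filter, mem_image, hkiff]
    constructor
    · intro ⟨_, hy⟩
      exact ⟨bxor c₁ y, hy, bxor_bxor_cancel_left c₁ y⟩
    · rintro ⟨a, ha, rfl⟩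
      exact ⟨mem_univ _, by rw [bxor_bxor_cancel_left]; exact ha⟩
  rw [hset, card_image_of_injective _ (fun x y h => by
      have := congrArg (bxor c₁) h; rwa [bxor_bxor_cancel_left, bxor_bxor_cancel_left] at this), hMcard] at hcard
  norm_num at hcard

end Summit.QuantumAdvantage.QuantumAdvantage.Theorems.CubicForrelation.NearExactIsExact

end
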